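import Mathlib
import HarnessLib
import HarnessLib.Audit
import Summits.AtomisticToContinuum.Statement
import Summits.AtomisticToContinuum.HydrodynamicLimit.Theorems.ImplosionDichotomyHsEosLowDensity
import HarnessLib.Audit.Status.Attr

/-!
Route: GermanoSplitLES

DORMANT since 2026-08-22T10:23:22Z (reconciler: no traction for 5.3 d (last activity item-evidence-added at 2026-08-17T03:11:28Z); parked, not closed — `ledger route dormant route-AtomisticToContinuum-GermanoSplitLES --off` to reactivat) — unstaffed, not closed; items shared with open routes are served there. `ledger route dormant <id> --off` reactivates.

# Route GermanoSplitLES — nature's LES converges pre-shock — kinetic-filter consistency +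
structure-function quiescence + filtered relative-entropy stability

It suffices to show X = KineticFilterConsistency ∧ MesoQuiescence ∧ FilteredEntropyStability ∧
EntropyTypicality ∧ KineticRangeControl
(realising card statistical-solutions-germano-split): the filtered relative-entropy bookkeeping
(crux GermanoSplitClosure := X → Statement, rank 7; in curried form also the frame item Assembly)
turns X into the
packing-guarded hard-sphere Euler limit, which since the Statement re-type p126922 (2026-08-16,
D-0032) IS the sub-problem Statement
`_root_.HydrodynamicLimit` (verbatim the former shared support HydroLimitInBand 3093/9133 =
`HydroLimitInBandDim 3`,
`hydroLimitInBandDim_three_iff_root`). The packing guard ρ_t(x)σ³ < η₀ is now a HYPOTHESIS of the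
Statement and every crux below was already
stated under it, so the former σ-uniform PDE density bound DiluteSelfConsistency (3091) is no longer
part of this route (dropped 2026-08-16
together with the now-redundant supports PhysicsToInBand 9202 and HydroLimitInBand 9133, whose
content GermanoSplitClosure absorbs). Read the hard-sphere
ensemble as nature's large-eddy simulation: U_N^ℓ := empirical (density, momentum, energy) fields
mollified at a KINETIC FILTER ℓ_N → 0 with
(N+1)ℓ_N³/log N → ∞. X1 = KineticFilterConsistency (card SS1): the weak-form hard-sphere-Euler
residual of U_N^{ℓ_N} tends to 0 in
probability for every smooth space–time test function (by exact microscopic conservation this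
residual IS the time-integrated subgrid
tensor ⟨τ_{ℓ_N}, ∇ψ⟩ — no collision vocabulary needed; "correlation-weighted mean for all bounded
cylindrical weights" is equivalent to
this in-probability form). X2 = MesoQuiescence (card SS2): the spatial L² structure function of
U_N^{ℓ_N}, time-integrated, tends to 0 as
r → 0 uniformly in N, in probability. X3 = FilteredEntropyStability (card SS3, crystallised): a
DETERMINISTIC finite-test-function
relative-entropy stability theorem for classical hs-Euler solutions among box-valued approximate
admissible fields. X4 = EntropyTypicality
(card A4): pathwise second law in probability for the coarse-grained hard-sphere entropy at any
fixed macroscopic filter. X5 =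
KineticRangeControl (card SS4): no mesoscopic vacuum / hot / dense pockets at the kinetic filter
before T, in probability.
Lean: `KineticFilterConsistency ∧ MesoQuiescence ∧ FilteredEntropyStability ∧ EntropyTypicality ∧
KineticRangeControl`

## Assembly
Assembly (frame #1, restated 2026-08-16) := KineticFilterConsistency → MesoQuiescence →
FilteredEntropyStability → EntropyTypicality →
KineticRangeControl → _root_.HydrodynamicLimit — `X → Statement` in curried form: the probabilistic
bookkeeping of the filtered relative-entropy
argument (Germano identity for the filtered residuals, Leonard terms ≤ C_K · structure function, FES
pathwise on the good events, entropy from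
ET, box from KRC, initial term from the LLN hypothesis; η₀ := min of the hypotheses' bands, σ₀ :=
min of their σ₀), provable now but long.
Since the crux-only repair 2026-08-16 (human ruling: `closes` may assume crux items only; an
assembly-kind item can be neither re-kinded nor
dropped) this content is STAFFED as the logically equivalent crux GermanoSplitClosure :=
KineticFilterConsistency ∧ MesoQuiescence ∧
FilteredEntropyStability ∧ EntropyTypicality ∧ KineticRangeControl → _root_.HydrodynamicLimit
(stmt-17775, rank 7; why-might-fail, sources and
proof plan live there), and the Assembly item is no longer a hypothesis of the deciding theorem; it
closes in one line once GermanoSplitClosure is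
proved (`fun h₁ h₂ h₃ h₄ h₅ => gsc ⟨h₁, h₂, h₃, h₄, h₅⟩`). The canonical frame `all six cruxes →
Statement` (verbatim the type of `closes`) was
installed at rev 8 and is rejected by the ground battery as trivially true (ground.trivial,
blocking), hence the curried content form is kept.
The route's DECIDING THEOREM (D-0027 §2.1), crux-only and sorry-free in glue.lean:
`theorem closes (h₁ : KineticFilterConsistency) (h₂ : MesoQuiescence) (h₃ :
FilteredEntropyStability) (h₄ : EntropyTypicality)
(h₅ : KineticRangeControl) (h₆ : GermanoSplitClosure) : _root_.HydrodynamicLimit := h₆ ⟨h₁, h₂, h₃,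
h₄, h₅⟩` (certified against the gate-rendered
file with `#h21_check_closes`: ok, codes [], axioms propext/Classical.choice/Quot.sound). History:
this conforming route re-files the items of the
retired route-AtomisticToContinuum-StatisticalGermanoSplit (closed not-a-thesis 2026-08-15T13:46Z
because its Assembly named the Literature
constant instead of the sub-problem Statement); repair 2026-08-16 after the Statement re-type
p126922 (old unguarded abbrev → packing-guarded
def): DiluteSelfConsistency (3091), PhysicsToInBand (9202) and HydroLimitInBand (9133) dropped,
Assembly restated without the DSC hypothesis;
crux-only repair 2026-08-16: FilteredEntropyStability and EntropyTypicality re-badged support → crux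
(unproved, load-bearing),
GermanoSplitClosure filed, `closes` re-certified crux-only. The statements of the five physics items
and of HsEosLowDensity are unchanged
throughout.

Rationale: WHY THIS LINE. Two technologies built for ENSEMBLES and FILTERS are transplanted with an explicit
dictionary (card): the statistical-solution framework for
hyperbolic systems (FjordholmLanthalerMishra2017; FjordholmEtAl2020: ensemble consistency +
structure-function regularity ⇒ dissipative
statistical solution, and weak–strong uniqueness collapses it to the Dirac at the classical
solution; LanthalerMishraParespulido2021 for the
structure-function hypothesis) and the exact two-filter algebra of LES (GermanoEtAl1991;
Germano2007: Leonard tensor = weighted second-order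
structure function; ConstantinETiti1994 / EyinkDrivas2018 commutator bounds). Typing the card forced
three simplifications that make the
line thin and its assembly provable: (i) the subgrid defect in weak form equals the weak-form Euler
residual of the mollified empirical
fields, so SS1 is a statement over existing declarations; (ii) the Germano identity in weak form,
Res^{ℓ₂}(ψ) = Res^{ℓ_N}(G_{ℓ₂}∗ψ) +
Leonard_{ℓ_N,ℓ₂}(ψ), is pure convolution algebra and the Leonard term is bounded by the structure
function on the range box (Taylor), so
SS2 is exactly what kills it; (iii) pre-shock, FLMW's statistical weak–strong uniqueness reduces to
Dafermos1979/Diperna1979 relative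
entropy run PATHWISE on the ℓ₂-filtered empirical fields at FIXED macroscopic ℓ₂ — no
Prokhorov/Skorokhod, no Young measures, no
weak-solution class. On the board this closing is shared in spirit with the sibling route
EntropyBookkeeping (opened in parallel today: fixed-φ
modulated-entropy Gronwall, MacroSecondLaw 4514, flux-locality cruxes 4515/4516 stated AT THE
MACROSCOPIC FILTER in the iterated limit) and
contrasts with DissipativeWeakStrong (measure-valued limits + BrezinaFeireisl2018, cruxes informal);
what THIS route adds is the Germano split of
the macroscopic-filter closure into two typed kinetic-scale cruxes — Res^{φ}(χ) = Res^{ℓ_N}(φ∗χ) +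
Leonard, so KineticFilterConsistency ∧
MesoQuiescence ∧ KineticRangeControl refine 4515/4516 (guarded form) — plus the Gronwall filed as a
typed deterministic PDE item; the packing guard, formerly
handed off to ImplosionLoophole's DiluteSelfConsistency, is since the Statement re-type p126922
(2026-08-16) a HYPOTHESIS of the Statement itself,
so the route's physics (crux GermanoSplitClosure) closes the sub-problem with no PDE density bound.
Imported areas: numerical analysis of conservation laws (statistical solutions), turbulence/LES
filter calculus, hyperbolic
PDE (relative entropy), equilibrium statistical mechanics (Georgii1994 large deviations + Liouville
invariance for the second law,
GoldsteinLebowitz2004 / GarridoGoldsteinLebowitz2004 typicality). Nearest particle-side analogue of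
the assembly: Serfaty2020 modulated
energy (mean-field, where the stress IS a functional of the empirical measure; here the collisional
closure is isolated in X1).

RANKED CRUXES. #2 KineticFilterConsistency (crux) — (card SS1, local equilibrium in its weakest
useful currency) under the packing guard ρσ³ < η₀ and for every admissible kinetic filter (φ_N ≥ 0
continuous, ∫φ_N = 1, supp ⊂ B(0,ℓ_N), φ_N ≤ A ℓ_N⁻³, Lip φ_N ≤ A ℓ_N⁻⁴, ℓ_N → 0, (N+1)ℓ_N³/log(N+2)
→ ∞): for t < T, every smooth space–time scalar test function ψ and vector test function Ψ on
[0,t]×𝕋³ and δ > 0, the local-Gibbs probability that one of the weak-form residuals on [0,t] — mass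
and energy against ψ, momentum against Ψ — of the mollified empirical fields U_N^{ℓ_N} = (ρ, m, E)
with hs fluxes (m, m⊗m/ρ + p𝟙, (E+p)m/ρ), p = hsPressure σ ρ θ(U), θ(U) = ⅔(E/ρ − |m|²/2ρ²), exceeds
δ tends to 0 (admissibility now reads: ∃A, φ_N ℓ_N³ ≤ A and |φ_N(x) − φ_N(y)| ℓ_N⁴ ≤ A·dist(x,y)).
[difficulty: open-problem] (why it might fail: It is dynamic local equilibrium (block Maxwellisation
+ equilibrium contact statistics) for deterministic hard spheres — the BoltzmannHypothesis wall; a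
persistent anisotropic kinetic stress at scale ℓ_N (as for the ideal-gas witness under shear)
refutes it.) [Spohn1991, OllaVaradhanYau1993, FjordholmLanthalerMishra2017, FjordholmEtAl2020,
Yau1991]
#3 MesoQuiescence (crux) — (card SS2, meso-quiescence = uniform structure-function decay) same
prefix and filters: for t < T and ε > 0 there are r > 0 and N₀ such that for all N ≥ N₀ and all
torus shifts h with |h| < r, the local-Gibbs probability that ∫₀ᵗ∫_{𝕋³} |U_N^{ℓ_N}(s,x+h) −
U_N^{ℓ_N}(s,x)|² dx ds > ε is < ε (no N-independent energy between the kinetic and the macroscopic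
scale; via Germano2007 / ConstantinETiti1994 this is exactly Leonard_{ℓ_N,ℓ₂} → 0). [difficulty: XL]
(why it might fail: An N-independent mesoscale energy plateau before T (thermal seeds ~N^{-1/2}
amplified at effective Reynolds ~N^{1/3} faster than the smooth profile's e^{γt}, i.e. pre-shock
spontaneous stochasticity) breaks the r → 0 limit; MD-visible at N = 10⁴–10⁶.) [Germano2007,
doi:10.1063/1.2714078, LanthalerMishraParespulido2021, EyinkDrivas2018,
doi:10.1103/physrevx.8.011022, ConstantinETiti1994, EyinkPeng2025]
#4 FilteredEntropyStability (crux, rank 4; badged support by the 2026-08-15 retriage as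
theorem-grade, crux again since the 2026-08-16 crux-only repair: unproved and load-bearing in
`closes`) — (card SS3 crystallised; deterministic PDE) ∃ η₀ > 0: for every σ > 0, every classical
hs-Euler solution Ū = (ρ̄, ρ̄ū, Ē) on [0,T), t < T and every box K = {c ≤ ρ ≤ C_ρ, |m| ≤ C, E ≤ C,
θ(U) ≥ c} with C_ρσ³ < η₀ containing range Ū|[0,t] strictly: ∀ ε ∃ δ and finitely many smooth test
functions (Ψ^ρ_i, Ψ^E_i, Ψ^m_i) on [0,t]×𝕋³ such that any jointly measurable K-valued V = (V^ρ, V^m,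
V^E) with ‖V(0) − Ū(0)‖²_{L²} ≤ δ, ∫η(V(s)) ≤ ∫η(Ū(0)) + δ (η = −ρ s_hs, s_hs = 3/2 log θ − log ρ −
hsExcessFreeEnergy(ρσ³)) and weak-form residuals against the Ψ_i of modulus ≤ δ on every [0,s]
satisfies ‖V(s) − Ū(s)‖²_{L²} ≤ ε for all s ≤ t (Dafermos relative entropy with Ψ = Dη(Ū);
Gronwall). [deps: HsEosLowDensity] [difficulty: M] (why it might fail: Needs UNIFORM
(positive-Hessian, not just strict) convexity of −ρs_hs and C² fluxes on K — true only at packing <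
η₀ via HsEosLowDensity; deriv of the limsup-defined f_ex and derivWithin at t-endpoints must be
junk-free on K×[0,t].) [Dafermos1979, Diperna1979, BrezinaFeireisl2018, FjordholmEtAl2020,
FeireislNovotny2012]
#5 EntropyTypicality (crux, rank 5; badged support by the 2026-08-15 retriage as known-mechanism,
crux again since the 2026-08-16 crux-only repair: unproved and load-bearing in `closes`) — (card A4,
pathwise second law in probability) same guarded prefix; for every FIXED continuous kernel G ≥ 0
with ∫G = 1, t < T, δ > 0 and dilute box (c, C_ρ, C) with C_ρσ³ < η₀: the local-Gibbs probability
that the G-mollified empirical fields at time t lie in the box everywhere AND their coarse-grained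
hard-sphere entropy ∫ρ_G(3/2 log θ_G − log ρ_G − f_ex(ρ_Gσ³)) is below the initial macroscopic
entropy ∫ρ̄₀(3/2 log θ̄₀ − log ρ̄₀ − f_ex(ρ̄₀σ³)) − δ tends to 0. Mechanism: Boltzmann–Einstein
typicality — static large deviations of coarse-grained (ρ,m,E) profiles under the flow-INVARIANT
canonical Gibbs measure (rate βE − S_hs), transferred to local-Gibbs data using dP₀/dλ =
exp((N+1)·linear functional of the initial empirical fields) and pathwise energy conservation
(exponent gap = δ). Differs from EntropyBookkeeping.MacroSecondLaw (stmt-4514): specialised to the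
flow map, boxed (dilute) instead of density-floored, and benchmarked on the Euler data (ρ,u,θ)(0) so
that no local-Gibbs LLN fact is needed in the assembly; 4514 together with localGibbs_lln implies
it, so either closes X4. [difficulty: L] (why it might fail: Needs the LD upper bound for
coarse-grained (ρ,m,E) profiles of the canonical hard-sphere gas on dilute boxes with rate βE − S_hs
(Georgii1994-type) plus a slab-partition transfer to local-Gibbs tilts; any leak in the exponent
bookkeeping (momentum shells, kernel G) must stay below δ.) [Georgii1994, GoldsteinLebowitz2004,
GarridoGoldsteinLebowitz2004, doi:10.1103/physrevlett.92.050602, Ruelle1969, LebowitzPenrose1964,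
Lanford1975]
#6 KineticRangeControl (crux) — (card SS4, tails) for every target band η₀ > 0 and profiles ∃ σ₀ ∀ σ
< σ₀, for every guarded classical solution, admissible kinetic filter and t < T there are 0 < c,
C_ρ, C with C_ρσ³ < η₀, the classical solution strictly inside the box on [0,t], and local-Gibbs
probability → 1 that the mollified empirical fields U_N^{ℓ_N}(s,x) stay in the box {c ≤ ρ ≤ C_ρ, |m|
≤ C, E ≤ C, θ ≥ c} for ALL s ≤ t and x ∈ 𝕋³ (no mesoscopic vacuum, hot or dense pockets are created
by the dynamics before T). [difficulty: XL] (why it might fail: A sup over (s,x) of block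
observables at scale ℓ_N is a DYNAMIC moderate-deviation statement: static typicality only reaches
events rarer than exp(−N·I(U₀)) while block tails are exp(−cNℓ_N³); one transient pocket of size ℓ_N
with non-vanishing probability refutes it.) [Spohn1991, OllaVaradhanYau1993, KipnisLandim1999,
GarridoGoldsteinLebowitz2004, doi:10.1103/physrevlett.92.050602]
#9 HsEosLowDensity (support; PROVED 2026-08-16, Theorems.hsEosLowDensity_proof) — (shared, =
stmt-AtomisticToContinuum-0768) hard-sphere equation of state at low density: f_ex analytic on (−η₀,
η₀), agrees with hsExcessFreeEnergy on [0,η₀), F(0)=0, F′(0)=2π/3, and the canonical limit exists;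
the EOS input of FilteredEntropyStability (C² fluxes, uniform convexity of −ρs_hs at small packing).
[difficulty: L] [Ruelle1969, LebowitzPenrose1964]
#7 GermanoSplitClosure (crux, rank 7; filed 2026-08-16 in the crux-only repair) —
KineticFilterConsistency ∧ MesoQuiescence ∧ FilteredEntropyStability ∧ EntropyTypicality ∧
KineticRangeControl → _root_.HydrodynamicLimit (frame form X → Statement, X the thesis conjunction):
the route's assembly mathematics, the probabilistic bookkeeping of the filtered relative-entropy
argument (the same statement, curried, is the frame item Assembly; earlier the support
PhysicsToInBand 9202 → HydroLimitInBand 9133; provable now from the five, standard but long). Proof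
plan: fix ε; FES gives δ and test functions Ψ_i = Dη(Ū)-type on KRC's box; choose an even bump G =
G_{ℓ₂} with ℓ₂ so small that ‖Ū₀∗G − Ū₀‖ and the MesoQuiescence radius are below δ; run FES pathwise
on V = U_N^{ℓ_N}∗G on the intersection of the good events: residuals of V against Ψ_i = residuals of
U_N^{ℓ_N} against G∗Ψ_i (Germano, KFC) + Leonard terms ≤ C_K·structure function (Taylor on the box,
MQ, Fubini/Markov in (h,h′)); entropy from ET at kernel φ_{ℓ_N}∗G ≈ G (uniform continuity of G on
the box, finite time net, o(1) collision jumps); box from KRC (the box is convex, averaging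
preserves it); initial term from the LLN hypothesis; then ‖V(t) − Ū(t)‖_{L²} ≤ ε w.h.p. and testing
against continuous χ (uniform continuity, mass/energy bounds from conservation + LLN at t = 0) gives
TendstoHydroFieldsAt; η₀ := min of the hypotheses' η₀ (KRC is ∀ η₀), σ₀ := min of their σ₀. [deps:
KineticFilterConsistency, MesoQuiescence, FilteredEntropyStability, EntropyTypicality,
KineticRangeControl] [difficulty: L] (why it might fail: composition, not substance — ET and KFC are
fixed-time, rate-less limits, so only finitely many N-independent times can be fed in, while FES
consumes box/entropy/residual bounds of V = U^{ℓ_N}∗G for ALL s ≤ t: s ↦ V(s) must be equicontinuous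
with an N-uniform modulus w.h.p., and the collisional momentum/energy transfer and the energy
carried by fast particles have no such bound from the conservation laws + the KRC box; in addition
ET is typed at the fixed kernel G, not φ_N∗G (kernel-continuity on a slightly enlarged box), and
junk orbits off Φ.good must be P-null (they are: localGibbsLaw ≪ Liouville). If the time-uniformity
fails, the five do not compose AS TYPED and the tenure move is a sup-in-s restatement of ET/KFC (KRC
already is), not closing the route.) [FjordholmEtAl2020, Germano2007, Dafermos1979,
ConstantinETiti1994, Spohn1991]
#1 Assembly (assembly, frame; restated 2026-08-16) — KineticFilterConsistency → MesoQuiescence →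
FilteredEntropyStability → EntropyTypicality → KineticRangeControl → _root_.HydrodynamicLimit: `X →
Statement` in curried form, logically equivalent to the crux GermanoSplitClosure (#7), which carries
the staffing, why-might-fail, sources and proof plan; not a hypothesis of `closes` (crux-only rule);
closes in one line once GermanoSplitClosure is proved. (The canonical frame `all six cruxes →
Statement`, = the type of `closes`, was installed at rev 8 and rejected by the ground battery as
ground.trivial, so the content form is kept.) [deps: = GermanoSplitClosure] [difficulty: L, via #7]
DROPPED 2026-08-16 (repair after the Statement re-type p126922): DiluteSelfConsistency (stmt-3091,
the σ-uniform PDE density bound that turned HydroLimitInBand into the OLD unguarded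
HydrodynamicLimit; re-badged crux in this route by retriage g2) — not load-bearing once the
Statement is the guarded conjunct; it stays on the ledger for the ~40 other routes wanting it
(DenseExcursion → ¬DSC machine-checked, NegGlue3091). HydroLimitInBand (stmt-9133 ≡ 3093) — now
VERBATIM the sub-problem Statement (`hydroLimitInBandDim_three_iff_root`, definitional), redundant
as an item here; stays wanted by LaxScheme, ImplosionDichotomy and others. PhysicsToInBand
(stmt-9202, five → HydroLimitInBand) — merged into the restated Assembly (same content, conclusion
now the Statement by name).

TWO-LAYER PLAN. Foreseen glued splits (none filed now): KineticFilterConsistency ⇐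
KineticStressIsotropy (kinetic part of τ_{ℓ_N}: block second velocity
moments isotropic with trace fixed by E − |m|²/2ρ, in probability) → ContactVirial (collisional
momentum/energy transfer at scale ℓ_N equals
ρθ(Z(ρσ³) − 1) in weak form: mesoscopic virial theorem, Spohn1991 (3.15)) →
KineticFilterConsistency; the glue is the exact microscopic
balance law for mollified empirical fields (Irving–Kirkwood/Hardy form) and is provable now.
MesoQuiescence ⇐ ThermalFloor (static: S²_r ≤
C‖∇Ū‖²r² + C/(Nℓ_N³) under local Gibbs laws) → NoMesoscaleAmplification (dynamic: linearised-Euler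
growth e^{γt} of N^{-1/2} seeds) →
MesoQuiescence. EntropyTypicality ⇐ StaticProfileLDP (Georgii1994-type upper bound on dilute boxes)
→ InvarianceTransfer (Liouville +
energy conservation + slab partition of the local-Gibbs tilt) → EntropyTypicality.
GermanoSplitClosure may be split into GermanoWeakForm
(convolution algebra + Leonard ≤ C_K S²) → FilteredGronwallInProbability → GermanoSplitClosure if a
prover asks.

KILL CRITERIA. ¬MesoQuiescence exhibited (an N-independent mesoscale energy plateau before T, by
theorem or by a certified MD computation the refuters
accept) closes the route `refuted:MesoQuiescence` and would be major news (pre-shock spontaneous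
stochasticity) — hand it to card
ehrenfest-horizon-instability. ¬KineticFilterConsistency for some smooth dilute pre-shock data
refutes every flux-closure route at once
(DissipativeWeakStrong's FluxClosure 0823 included) and strongly suggests ¬HydroLimitInBand: file it
as a statement. ¬KineticRangeControl
alone forces a pivot: restate X1/X2/X4 on the range event and replace the box by uniform
integrability (FLMW's (A1)) — FES then needs the
relative-energy (Feireisl) form instead of Dafermos on a compact box. FilteredEntropyStability
cannot be refuted in substance (theorem-grade);
a Lean-junk refutation is repaired by restating. GermanoSplitClosure likewise cannot fail in
substance short of a composition mismatch between its five hypotheses (ET/KFC fixed-time and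
rate-less vs FES for all s ≤ t at the N-dependent kernel φ_{ℓ_N}∗G, i.e. N-uniform
time-equicontinuity of the doubly mollified fields); such a mismatch is repaired by sup-in-s
restatements of ET/KFC, it does not close the route. DenseExcursion (3090) proved /
DiluteSelfConsistency refuted no longer bears on this route
(the Statement IS the guarded conjunct since p126922; DSC dropped). MacroSecondLaw (4514) proved
together with localGibbs_lln closes X4 by specialisation;
EntropyBookkeeping's flux-locality cruxes 4515/4516 proved directly would moot X1 ∧ X2 as a pair
(the split then only assigns credit).
HydroLimitInBand = HydrodynamicLimit proved elsewhere moots the route.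

NOT DECOMPOSED YET. The kinetic/collisional split of X1 (needs the mollified balance-law lemma
first); the static-vs-dynamic split of X2 and X5; the LDP
behind X4; constants (η₀ bands, box margins, the rate in (N+1)ℓ³/log N); the existence of admissible
filter families and even bumps on 𝕋³
(elementary, rides with GermanoSplitClosure via --supports); uniform-integrability variants of X5;
anything post-shock (statistical solutions
may be non-Dirac there — outlook of the card, not claimed).

CHEAPEST FALSIFIER. Pen-and-paper calibration on the two catalogued kernels, then one lookup. (a)
Ideal gas (BoltzmannHypothesis kernel, free flight of a
sheared local Maxwellian): X2, X4, X5 hold (free streaming keeps mollified fields smooth and in the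
box; entropy of coarse-grained free flow
does not drop) while X1 FAILS (kinetic stress stays anisotropic ∝ t·|∇u|) — checked by hand: the
split assigns blame to X1, as it must; if
instead X2 failed for the ideal gas the route is mis-designed. (b) Lookup done: FLMW 2020
(FjordholmEtAl2020) prove weak–strong uniqueness of
dissipative statistical solutions only for systems with uniformly convex entropy and Dirac data at
Lipschitz solutions — matching the
compact-box form of FES rather than an energy-class form; hence FES is stated on boxes and X5
carries the range. (c) The MD test of X2
(structure functions of block momentum fields at φ = 0.05, N = 10⁴–10⁶, decaying shear + sound pulse
collapsing on C r² + C/(Nr³)) is the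
cheapest EMPIRICAL kill; not run here (kit not in this unit's payload).

NUMBERS. Filters: ℓ_N → 0 with (N+1)ℓ_N³/log(N+2) → ∞ (below that, vacuum pockets exist already at t
= 0: expected number of empty ℓ-blocks ≈
ℓ⁻³e^{−ρNℓ³} ↛ 0); mean free path ≈ N^{-1/3}/(√2πσ²), so admissible filters sit above it by
construction. Thermal floor of the structure
function ≈ θ/(ρ(N+1)ℓ_N³) → 0. Second virial coefficient: Z(η) = 1 + (2π/3)η + O(η²)
(HsEosLowDensity), so (ηZ)′ > 0 and −ρs_hs is
uniformly convex for η < η₀ small. Effective Reynolds number of the particle flow ≈ N^{1/3}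
(viscosity ∼ mean free path × thermal speed).
Items at open: 10 (5 cruxes, 4 support, 1 assembly); after two retriages and the two 2026-08-16
repairs (Statement re-type, crux-only `closes`): 8 items — 6 cruxes (KineticFilterConsistency 2,
MesoQuiescence 3,
FilteredEntropyStability 4, EntropyTypicality 5, KineticRangeControl 6, GermanoSplitClosure 7 = X →
Statement), 1 proved support (HsEosLowDensity), 1 assembly (frame `X → Statement` curried, ≡
GermanoSplitClosure, not a `closes` hypothesis); `closes` = h₆ ⟨h₁,…,h₅⟩ over the six cruxes,
crux-only.

DEFINITION REQUESTS. None needed to state the items (mollified empirical fields, residuals,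
entropies are spelled out inline over HardSphereEuler.lean and
TorusCalculus.lean). Nice-to-have, not filed: a Literature notion `TorusMollifier` (admissible
kernel families on UnitAddTorus) and
`empiricalStressField` (kinetic + collisional momentum flux as a matrix-valued measure) — the latter
is what the foreseen split of X1 needs;
it coincides with the pending definition request of DissipativeWeakStrong's FluxClosure (0823).

Novelty: Searches (2026-08-15): `lit search --source crossref "statistical solutions hyperbolic conservation
laws Fjordholm Lanthaler Mishra"` (11:
doi:10.1007/s00205-017-1145-9, doi:10.1142/s0218202520500141, doi:10.1137/17m1154874,
doi:10.1007/s10208-015-9299-z, no particle systems);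
`lit search --source crossref "large deviations equivalence of ensembles Gibbsian particle systems
Georgii"` (10: doi:10.1007/bf01199021,
doi:10.1007/bf02179874); `lit search --source crossref "Boltzmann entropy nonequilibrium typicality
Goldstein Lebowitz"` (10:
doi:10.1016/j.physd.2004.01.008, doi:10.1103/physrevlett.92.050602, doi:10.1007/s10955-024-03311-x);
`lit search --source crossref "modulated
energy mean field limit Serfaty"` (10: doi:10.1215/00127094-2020-0019, doi:10.5802/slsedp.135); `lit
galaxy search "Germano identity" --star all`
(8 pdf hits, all engineering LES: Meneveau–Lund–Cabot 1994, dynamic SGS models; no kinetic theory);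
`lit galaxy search "dissipative statistical
solutions" --star all` (2: arXiv:1912.04323, an ETH SAM report); `lit galaxy search "statistical
solutions of the compressible Euler equations"
/ "hydrodynamic limit hard spheres relative entropy coarse-grained" --star all` (0); `lit frontier
AtomisticToContinuum --since 2020` (30 rows;
hydro-relevant: arXiv:2310.13338 heat equation from deterministic dynamics, arXiv:2602.04407 DHM
exposition — none on statistical solutions);
`lit bridges AtomisticToContinuum --cross any` (Golse doi:10.1090/bull/1650 survey only); the 9  [refs: 10.1007/s00205-017-1145-9, 10.1142/s0218202520500141, 10.1137/17m1154874, 10.1007/s10208-015-9299-z, 10.1007/bf01199021, 10.1007/bf02179874, 10.1016/j.physd.2004.01.008, 10.1103/physrevlett.92.050602, 10.1007/s10955-024-03311-x, 10.1215/00127094-2020-0019, 10.5802/slsedp.135, 10.1090/bull/1650, 10.1103/physrevx.8.011022, 1912.04323, 2310.13338, 2602.04407, doi:10.1007/s00205-017-1145-9, doi:10.114]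

Barriers (technique_class: statistical-solutions LES-filter-identity weak-strong): - technique_class: statistical-solutions LES-filter-identity weak-strong
- Literature.Barriers.AtomisticToContinuum.BoltzmannHypothesisBarrier: it does not evade it; the bet
is that the ergodic content is isolated in ONE typed crux (KineticFilterConsistency) in its weakest
useful currency (weak form, in probability, pre-shock, dilute guard), calibrated on the barrier's
kernel: the ideal gas passes X2/X4/X5 and fails X1.
- Literature.Barriers.AtomisticToContinuum.WildSolutionsBarrier: identification is by relative
entropy against the CLASSICAL solution for t < T from LLN (Dirac) data, where admissible wild
solutions do not compete; nothing post-shock is claimed.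
- Literature.Barriers.AtomisticToContinuum.ShockFormationBarrier: respected — everything is
quantified over t < T, T a classical existence time; FES uses smoothness of Ū on [0,t].
- Literature.Barriers.AtomisticToContinuum.NoBVEstimatesMultiDBarrier: no BV or Lᵖ (p ≠ 2) stability
is used; compactness-type input is the L² structure function of the ENSEMBLE (X2) and stability is
L²-relative-entropy against a smooth solution, outside Rauch's class.
- Literature.Barriers.AtomisticToContinuum.HighMomentumCutoffBarrier: enters only through the box of
X5 (energy density ≤ C at scale ℓ_N, in probability), flagged as a crux, not assumed.
- Literature.Barriers.AtomisticToContinuum.VelocityReversalBarrier: all statements are laws of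
mollified fields under the local-Gibbs ensemble, in probability; no phase-point or every-datum cla

History (route lifecycle, newest last):
- 2026-08-16T23:18:19Z · rev 5: restated Assembly (stmt-AtomisticToContinuum-9203) — route-repair (statement-revised, p126922 retype hydro2): closes re-elaborated. The re-typed Statement _root_.HydrodynamicLimit (packing-guarded def) is VERBATIM (planner-rrepair-AtomisticToContinuum-GermanoSp-1927d6d9-0)
- 2026-08-16T23:18:19Z · rev 5: dropped DiluteSelfConsistency, PhysicsToInBand, HydroLimitInBand — route-repair (statement-revised, p126922 retype hydro2): closes re-elaborated. The re-typed Statement _root_.HydrodynamicLimit (packing-guarded def) is VERBATIM (planner-rrepair-AtomisticToContinuum-GermanoSp-1927d6d9-0)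
- 2026-08-16T23:42:13Z · rev 8: restated Assembly (stmt-AtomisticToContinuum-17398) — route-repair (crux-only closes rule 2026-08-16), step 3/3: restate Assembly to the canonical frame `all six cruxes → Statement` (KFC → MQ → FES → ET → KRC → Ger (planner-rbadge-AtomisticToContinuum-GermanoSpl-deb56274-0)
- 2026-08-16T23:43:25Z · rev 9: restated Assembly (stmt-AtomisticToContinuum-17868) — route-repair (crux-only closes rule), step 3b: the canonical frame Assembly `all six cruxes → Statement` (rev 8, stmt-17868) is flagged ground.trivial (blocking (planner-rbadge-AtomisticToContinuum-GermanoSpl-deb56274-0)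
- 2026-08-22T10:23:22Z · DORMANT — reconciler: no traction for 5.3 d (last activity item-evidence-added at 2026-08-17T03:11:28Z); parked, not closed — `ledger route dormant route-AtomisticToConti (operator:999:3302396)

sub-problem: HydrodynamicLimit · status: dormant · opened planner-plancard-AtomisticToContinuum-Hydrody-1f589952-0 2026-08-15T13:51:58Z · rev 10 · ledger route-AtomisticToContinuum-GermanoSplitLES
GENERATED by the gate from the ledger (D-0016/17). Provers cite these decls: `theorem foo : Summit.AtomisticToContinuum.HydrodynamicLimit.Theses.GermanoSplitLES.<Decl> := …` in Summits/AtomisticToContinuum/HydrodynamicLimit/Theorems/<Name>.lean.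
-/

namespace Summit.AtomisticToContinuum.HydrodynamicLimit.Theses.GermanoSplitLES

open scoped BigOperators Topology Manifold Classical MeasureTheory ProbabilityTheory Matrix InnerProductSpace ComplexConjugate ContinuousMap
open Filter Set Function TopologicalSpace MeasureTheory

attribute [summit_statement] _root_.HydrodynamicLimit

/-- item stmt-AtomisticToContinuum-9197 · crux · rank 2 · open · by planner
why it might fail: It IS propagation of local equilibrium for DETERMINISTIC hard spheres off equilibrium (traceless kinetic stress → 0, collisional flux → ρθ(Z−1)𝟙 at scale ℓ_N): the BoltzmannHypothesis wall, proved only with velocity noise (OllaVaradhanYau1993 Thm 1.1); a persistent anisotropic stress refutes it.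
sources: Spohn1991, OllaVaradhanYau1993, Yau1991, DengHaniMa2024, FjordholmLanthalerMishra2017, FjordholmEtAl2020
[crux] (card SS1, local equilibrium in its weakest useful currency) under the packing guard ρσ³ < η₀
and for every admissible kinetic filter (φ_N ≥ 0 continuous, ∫φ_N = 1, supp ⊂ B(0,ℓ_N), φ_N ≤ A
ℓ_N⁻³, Lip φ_N ≤ A ℓ_N⁻⁴, ℓ_N → 0, (N+1)ℓ_N³/log(N+2) → ∞): for t < T, every smooth space–time
scalar test function ψ and vector test function Ψ on [0,t]×𝕋³ and δ > 0, the local-Gibbs probability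
that one of the weak-form residuals on [0,t] — mass and energy against ψ, momentum against Ψ — of
the mollified empirical fields U_N^{ℓ_N} = (ρ, m, E) with hs fluxes (m, m⊗m/ρ + p𝟙, (E+p)m/ρ), p =
hsPressure σ ρ θ(U), θ(U) = ⅔(E/ρ − |m|²/2ρ²), exceeds δ tends to 0 (admissibility now reads: ∃A,
φ_N ℓ_N³ ≤ A and |φ_N(x) − φ_N(y)| ℓ_N⁴ ≤ A·dist(x,y)). [difficulty: open-problem] -/
@[route_item "route-AtomisticToContinuum-GermanoSplitLES", crux]
def KineticFilterConsistency : Prop :=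
  ∃ η₀ : ℝ, 0 < η₀ ∧ ∀ (a₀ θ₀ : Literature.MathematicalPhysics.KineticTheory.T3 → ℝ) (u₀ : Literature.MathematicalPhysics.KineticTheory.T3 → Literature.MathematicalPhysics.KineticTheory.V3), Continuous a₀ → Continuous θ₀ → Continuous u₀ → (∀ x, 0 < a₀ x) → (∀ x, 0 < θ₀ x) → ∃ σ₀ : ℝ, 0 < σ₀ ∧ ∀ σ : ℝ, 0 < σ → σ < σ₀ → ∀ (T : ℝ) (ρ θ : ℝ → Literature.MathematicalPhysics.KineticTheory.T3 → ℝ) (u : ℝ → Literature.MathematicalPhysics.KineticTheory.T3 → Literature.MathematicalPhysics.KineticTheory.V3), Literature.MathematicalPhysics.KineticTheory.IsHardSphereEulerSolution σ T ρ u θ → (∀ t ∈ Set.Ico 0 T, ∀ x, ρ t x * σ ^ 3 < η₀) → ∀ Φ : (N : ℕ) → Literature.Analysis.FluidPDE.HardSphereFlow (Literature.Analysis.FluidPDE.Torus.geometry (Fin 3)) (Literature.MathematicalPhysics.KineticTheory.hsDiameter σ N) (N + 1), Literature.MathematicalPhysics.KineticTheory.TendstoHydroFieldsAt (fun N => Literature.MathematicalPhysics.KineticTheory.localGibbsLaw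 σ a₀ u₀ θ₀ N (Φ N)) Φ ρ u θ 0 → ∀ (φ : ℕ → Literature.MathematicalPhysics.KineticTheory.T3 → ℝ) (ℓ : ℕ → ℝ), (∀ N, Continuous (φ N)) → (∀ N x, 0 ≤ φ N x) → (∀ N, ∫ x, φ N x = 1) → (∀ N x, ℓ N < Literature.Analysis.FluidPDE.Torus.euclidDist x 0 → φ N x = 0) → (∃ A : ℝ, ∀ N x y, φ N x * ℓ N ^ 3 ≤ A ∧ |φ N x - φ N y| * ℓ N ^ 4 ≤ A * Literature.Analysis.FluidPDE.Torus.euclidDist x y) → (∀ N, 0 < ℓ N) → Filter.Tendsto ℓ Filter.atTop (nhds 0) → Filter.Tendsto (fun N : ℕ => ((N : ℝ) + 1) * ℓ N ^ 3 / Real.log ((N : ℝ) + 2)) Filter.atTop Filter.atTop → ∀ t ∈ Set.Ico 0 T, ∀ (ψ : ℝ → Literature.MathematicalPhysics.KineticTheory.T3 → ℝ) (Ψ : ℝ → Literature.MathematicalPhysics.KineticTheory.T3 → Literature.MathematicalPhysics.KineticTheory.V3), Literature.Analysis.FunctionSpaces.Torus.IsSmoothSpaceTimeOn (Set.Icc 0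 t) ψ → Literature.Analysis.FunctionSpaces.Torus.IsSmoothSpaceTimeOn (Set.Icc 0 t) Ψ → ∀ δ : ℝ, 0 < δ → Filter.Tendsto (fun N : ℕ => Literature.MathematicalPhysics.KineticTheory.localGibbsLaw σ a₀ u₀ θ₀ N (Φ N) {z | let ρℓ := fun s x => Literature.MathematicalPhysics.KineticTheory.empiricalDensityField ((Φ N).flow s z) (fun y => φ N (x - y)); let mℓ := fun s x => Literature.MathematicalPhysics.KineticTheory.empiricalMomentumField ((Φ N).flow s z) (fun y => φ N (x - y)); let Eℓ := fun s x => Literature.MathematicalPhysics.KineticTheory.empiricalEnergyField ((Φ N).flow s z) (fun y => φ N (x - y)); let θℓ := fun s x => 2 / 3 * (Eℓ s x / ρℓ s x - ‖mℓ s x‖ ^ 2 / (2 * ρℓ s x ^ 2)); let pℓ := fun s x => Literature.MathematicalPhysics.KineticTheory.hsPressure σ (ρℓ s x) (θℓ s x); δ < |(∫ x, ρℓ t x * ψ t x) - (∫ x, ρℓ 0 x * ψ 0 x) - ∫ s in (0 : ℝ)..t, ∫ x, (ρℓ s x * Literature.Analysis.FunctionSpaces.Torus.timeDerivWithin (Set.Icc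 0 t) ψ s x + inner ℝ (mℓ s x) (Literature.Analysis.FunctionSpaces.Torus.gradient (ψ s) x))| ∨ δ < |(∫ x, Eℓ t x * ψ t x) - (∫ x, Eℓ 0 x * ψ 0 x) - ∫ s in (0 : ℝ)..t, ∫ x, (Eℓ s x * Literature.Analysis.FunctionSpaces.Torus.timeDerivWithin (Set.Icc 0 t) ψ s x + (Eℓ s x + pℓ s x) / ρℓ s x * inner ℝ (mℓ s x) (Literature.Analysis.FunctionSpaces.Torus.gradient (ψ s) x))| ∨ δ < |(∫ x, inner ℝ (mℓ t x) (Ψ t x)) - (∫ x, inner ℝ (mℓ 0 x) (Ψ 0 x)) - ∫ s in (0 : ℝ)..t, ∫ x, (inner ℝ (mℓ s x) (Literature.Analysis.FunctionSpaces.Torus.timeDerivWithin (Set.Icc 0 t) Ψ s x) + inner ℝ (mℓ s x) (Literature.Analysis.FunctionSpaces.Torus.fderiv (Ψ s) x (mℓ s x)) / ρℓ s x + pℓ s x * Literature.Analysis.FunctionSpaces.Torus.divergence (Ψ s) x)|}) Filter.atTop (nhds 0)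

/-- item stmt-AtomisticToContinuum-9198 · crux · rank 3 · open · by planner
why it might fail: Must hold UNIFORMLY in N as r → 0: thermal seeds ~(Nℓ_N³)^{-1/2} amplified by mesoscale shear/acoustic instabilities at effective Reynolds ~N^{1/3} could leave an N-independent energy plateau between ℓ_N and r before T (thermal-noise spontaneous stochasticity, arXiv:2401.13881); no known bound.
sources: Germano2007, ConstantinETiti1994, EyinkDrivas2018, LanthalerMishraParespulido2021, BandakEtAl2024, arXiv:2401.13881
[crux] (card SS2, meso-quiescence = uniform structure-function decay) same prefix and filters: for t
< T and ε > 0 there are r > 0 and N₀ such that for all N ≥ N₀ and all torus shifts h with |h| < r,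
the local-Gibbs probability that ∫₀ᵗ∫_{𝕋³} |U_N^{ℓ_N}(s,x+h) − U_N^{ℓ_N}(s,x)|² dx ds > ε is < ε (no
N-independent energy between the kinetic and the macroscopic scale; via Germano2007 /
ConstantinETiti1994 this is exactly Leonard_{ℓ_N,ℓ₂} → 0). [difficulty: XL] -/
@[route_item "route-AtomisticToContinuum-GermanoSplitLES", crux]
def MesoQuiescence : Prop :=
  ∃ η₀ : ℝ, 0 < η₀ ∧ ∀ (a₀ θ₀ : Literature.MathematicalPhysics.KineticTheory.T3 → ℝ) (u₀ : Literature.MathematicalPhysics.KineticTheory.T3 → Literature.MathematicalPhysics.KineticTheory.V3), Continuous a₀ → Continuous θ₀ → Continuous u₀ → (∀ x, 0 < a₀ x) → (∀ x, 0 < θ₀ x) → ∃ σ₀ : ℝ, 0 < σ₀ ∧ ∀ σ : ℝ, 0 < σ → σ < σ₀ → ∀ (T : ℝ) (ρ θ : ℝ → Literature.MathematicalPhysics.KineticTheory.T3 → ℝ) (u : ℝ → Literature.MathematicalPhysics.KineticTheory.T3 → Literature.MathematicalPhysics.KineticTheory.V3), Literature.MathematicalPhysics.KineticTheory.IsHardSphereEulerSolution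 σ T ρ u θ → (∀ t ∈ Set.Ico 0 T, ∀ x, ρ t x * σ ^ 3 < η₀) → ∀ Φ : (N : ℕ) → Literature.Analysis.FluidPDE.HardSphereFlow (Literature.Analysis.FluidPDE.Torus.geometry (Fin 3)) (Literature.MathematicalPhysics.KineticTheory.hsDiameter σ N) (N + 1), Literature.MathematicalPhysics.KineticTheory.TendstoHydroFieldsAt (fun N => Literature.MathematicalPhysics.KineticTheory.localGibbsLaw σ a₀ u₀ θ₀ N (Φ N)) Φ ρ u θ 0 → ∀ (φ : ℕ → Literature.MathematicalPhysics.KineticTheory.T3 → ℝ) (ℓ : ℕ → ℝ), (∀ N, Continuous (φ N)) → (∀ N x, 0 ≤ φ N x) → (∀ N, ∫ x, φ N x = 1) → (∀ N x, ℓ N < Literature.Analysis.FluidPDE.Torus.euclidDist x 0 → φ N x = 0) → (∃ A : ℝ, ∀ N x y, φ N x * ℓ N ^ 3 ≤ A ∧ |φ N x - φ N y| * ℓ N ^ 4 ≤ A * Literature.Analysis.FluidPDE.Torus.euclidDist x y) → (∀ N, 0 < ℓ N) → Filter.Tendsto ℓ Filter.atTop (nhds 0) → Filter.Tendsto (fun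 N : ℕ => ((N : ℝ) + 1) * ℓ N ^ 3 / Real.log ((N : ℝ) + 2)) Filter.atTop Filter.atTop → ∀ t ∈ Set.Ico 0 T, ∀ ε : ℝ, 0 < ε → ∃ r : ℝ, 0 < r ∧ ∃ N₀ : ℕ, ∀ N ≥ N₀, ∀ h : Literature.MathematicalPhysics.KineticTheory.T3, Literature.Analysis.FluidPDE.Torus.euclidDist h 0 < r → Literature.MathematicalPhysics.KineticTheory.localGibbsLaw σ a₀ u₀ θ₀ N (Φ N) {z | let ρℓ := fun s x => Literature.MathematicalPhysics.KineticTheory.empiricalDensityField ((Φ N).flow s z) (fun y => φ N (x - y)); let mℓ := fun s x => Literature.MathematicalPhysics.KineticTheory.empiricalMomentumField ((Φ N).flow s z) (fun y => φ N (x - y)); let Eℓ := fun s x => Literature.MathematicalPhysics.KineticTheory.empiricalEnergyField ((Φ N).flow s z) (fun y => φ N (x - y)); ε < ∫ s in (0 : ℝ)..t, ∫ x, ((ρℓ s (x + h) - ρℓ s x) ^ 2 + ‖mℓ s (x + h) - mℓ s x‖ ^ 2 + (Eℓ s (x + h) - Eℓ s x) ^ 2)} < ENNReal.ofReal ε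

/-- item stmt-AtomisticToContinuum-9199 · crux · rank 4 · open · by planner
why it might fail: Typing, not substance: needs UNIFORM convexity of −ρs_hs and C² fluxes on the box (only for Cρσ³ < η₀ inside HsEosLowDensity's radius, yet one η₀ serves ∀σ), V merely measurable in s, and junk-free deriv f_ex / derivWithin at the t-endpoint; a leak there breaks the ∀s≤t conclusion as typed.
sources: Dafermos1979, Diperna1979, Dafermos2005, BrezinaFeireisl2018, FjordholmEtAl2020
[crux] (card SS3 crystallised; deterministic PDE) ∃ η₀ > 0: for every σ > 0, every classical
hs-Euler solution Ū = (ρ̄, ρ̄ū, Ē) on [0,T), t < T and every box K = {c ≤ ρ ≤ C_ρ, |m| ≤ C, E ≤ C,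
θ(U) ≥ c} with C_ρσ³ < η₀ containing range Ū|[0,t] strictly: ∀ ε ∃ δ and finitely many smooth test
functions (Ψ^ρ_i, Ψ^E_i, Ψ^m_i) on [0,t]×𝕋³ such that any jointly measurable K-valued V = (V^ρ, V^m,
V^E) with ‖V(0) − Ū(0)‖²_{L²} ≤ δ, ∫η(V(s)) ≤ ∫η(Ū(0)) + δ (η = −ρ s_hs, s_hs = 3/2 log θ − log ρ −
hsExcessFreeEnergy(ρσ³)) and weak-form residuals against the Ψ_i of modulus ≤ δ on every [0,s]
satisfies ‖V(s) − Ū(s)‖²_{L²} ≤ ε for all s ≤ t (Dafermos relative entropy with Ψ = Dη(Ū);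
Gronwall). [deps: HsEosLowDensity] [difficulty: M] -/
@[route_item "route-AtomisticToContinuum-GermanoSplitLES", crux]
def FilteredEntropyStability : Prop :=
  ∃ η₀ : ℝ, 0 < η₀ ∧ ∀ σ : ℝ, 0 < σ → ∀ (T : ℝ) (ρ θ : ℝ → Literature.MathematicalPhysics.KineticTheory.T3 → ℝ) (u : ℝ → Literature.MathematicalPhysics.KineticTheory.T3 → Literature.MathematicalPhysics.KineticTheory.V3), Literature.MathematicalPhysics.KineticTheory.IsHardSphereEulerSolution σ T ρ u θ → ∀ t ∈ Set.Ico 0 T, ∀ (c Cρ C : ℝ), 0 < c → Cρ * σ ^ 3 < η₀ → (∀ s ∈ Set.Icc 0 t, ∀ x, c < ρ s x ∧ ρ s x < Cρ ∧ ‖ρ s x • u s x‖ < C ∧ Literature.MathematicalPhysics.KineticTheory.totalEnergyDensity (ρ s x) (u s x) (θ s x) < C ∧ c < θ s x) → ∀ ε : ℝ, 0 < ε → ∃ δ : ℝ, 0 < δ ∧ ∃ (k : ℕ) (Ψρ ΨE : Fin k → ℝ → Literature.MathematicalPhysics.KineticTheory.T3 → ℝ) (Ψm : Fin k → ℝ →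 Literature.MathematicalPhysics.KineticTheory.T3 → Literature.MathematicalPhysics.KineticTheory.V3), (∀ i, Literature.Analysis.FunctionSpaces.Torus.IsSmoothSpaceTimeOn (Set.Icc 0 t) (Ψρ i) ∧ Literature.Analysis.FunctionSpaces.Torus.IsSmoothSpaceTimeOn (Set.Icc 0 t) (ΨE i) ∧ Literature.Analysis.FunctionSpaces.Torus.IsSmoothSpaceTimeOn (Set.Icc 0 t) (Ψm i)) ∧ ∀ (Vρ VE : ℝ → Literature.MathematicalPhysics.KineticTheory.T3 → ℝ) (Vm : ℝ → Literature.MathematicalPhysics.KineticTheory.T3 → Literature.MathematicalPhysics.KineticTheory.V3), Measurable (Function.uncurry Vρ) → Measurable (Function.uncurry VE) → Measurable (Function.uncurry Vm) → let Vθ : ℝ → Literature.MathematicalPhysics.KineticTheory.T3 → ℝ := fun s x => 2 / 3 * (VE s x / Vρ s x - ‖Vm s x‖ ^ 2 / (2 * Vρ s x ^ 2)); let Vp : ℝ → Literature.MathematicalPhysics.KineticTheory.T3 → ℝ := fun s x => Literature.MathematicalPhysics.KineticTheory.hsPressure σ (Vρ s x) (Vθ s x); (∀ s ∈ Set.Icc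 0 t, ∀ x, c ≤ Vρ s x ∧ Vρ s x ≤ Cρ ∧ ‖Vm s x‖ ≤ C ∧ VE s x ≤ C ∧ c ≤ Vθ s x) → (∫ x, ((Vρ 0 x - ρ 0 x) ^ 2 + ‖Vm 0 x - ρ 0 x • u 0 x‖ ^ 2 + (VE 0 x - Literature.MathematicalPhysics.KineticTheory.totalEnergyDensity (ρ 0 x) (u 0 x) (θ 0 x)) ^ 2)) ≤ δ → (∀ s ∈ Set.Icc 0 t, (∫ x, -(Vρ s x * (3 / 2 * Real.log (Vθ s x) - Real.log (Vρ s x) - Literature.MathematicalPhysics.KineticTheory.hsExcessFreeEnergy (Vρ s x * σ ^ 3)))) ≤ (∫ x, -(ρ 0 x * (3 / 2 * Real.log (θ 0 x) - Real.log (ρ 0 x) - Literature.MathematicalPhysics.KineticTheory.hsExcessFreeEnergy (ρ 0 x * σ ^ 3)))) + δ) → (∀ i, ∀ s ∈ Set.Icc 0 t, |(∫ x, Vρ s x * Ψρ i s x) - (∫ x, Vρ 0 x * Ψρ i 0 x) - ∫ r in (0 : ℝ)..s, ∫ x, (Vρ r x * Literature.Analysis.FunctionSpaces.Torus.timeDerivWithin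 (Set.Icc 0 t) (Ψρ i) r x + inner ℝ (Vm r x) (Literature.Analysis.FunctionSpaces.Torus.gradient (Ψρ i r) x))| ≤ δ ∧ |(∫ x, VE s x * ΨE i s x) - (∫ x, VE 0 x * ΨE i 0 x) - ∫ r in (0 : ℝ)..s, ∫ x, (VE r x * Literature.Analysis.FunctionSpaces.Torus.timeDerivWithin (Set.Icc 0 t) (ΨE i) r x + (VE r x + Vp r x) / Vρ r x * inner ℝ (Vm r x) (Literature.Analysis.FunctionSpaces.Torus.gradient (ΨE i r) x))| ≤ δ ∧ |(∫ x, inner ℝ (Vm s x) (Ψm i s x)) - (∫ x, inner ℝ (Vm 0 x) (Ψm i 0 x)) - ∫ r in (0 : ℝ)..s, ∫ x, (inner ℝ (Vm r x) (Literature.Analysis.FunctionSpaces.Torus.timeDerivWithin (Set.Icc 0 t) (Ψm i) r x) + inner ℝ (Vm r x) (Literature.Analysis.FunctionSpaces.Torus.fderiv (Ψm i r) x (Vm r x)) / Vρ r x + Vp r x * Literature.Analysis.FunctionSpaces.Torus.divergence (Ψm i r) x)| ≤ δ) → ∀ s ∈ Set.Icc 0 t, (∫ x, ((Vρ s x - ρ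 s x) ^ 2 + ‖Vm s x - ρ s x • u s x‖ ^ 2 + (VE s x - Literature.MathematicalPhysics.KineticTheory.totalEnergyDensity (ρ s x) (u s x) (θ s x)) ^ 2)) ≤ ε

/-- item stmt-AtomisticToContinuum-9200 · crux · rank 5 · open · by planner
why it might fail: Needs a profile-level LDP upper bound (speed N+1, rate s_eq − S_hs) for G-mollified (ρ,m,E) under the CANONICAL fixed-packing hard-sphere law plus the tilt transfer dP₀/dμ = e^{(N+1)Λ}; not in print for marked configurations — an o(N) exponent leak (kernel G, momentum shells, log Z_N) kills the gap.
sources: Georgii1994, GeorgiiZessin1993, GoldsteinLebowitz2004, GarridoGoldsteinLebowitz2004, Ruelle1969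
[crux] (card A4, pathwise second law in probability) same guarded prefix; for every FIXED continuous
kernel G ≥ 0 with ∫G = 1, t < T, δ > 0 and dilute box (c, C_ρ, C) with C_ρσ³ < η₀: the local-Gibbs
probability that the G-mollified empirical fields at time t lie in the box everywhere AND their
coarse-grained hard-sphere entropy ∫ρ_G(3/2 log θ_G − log ρ_G − f_ex(ρ_Gσ³)) is below the initial
macroscopic entropy ∫ρ̄₀(3/2 log θ̄₀ − log ρ̄₀ − f_ex(ρ̄₀σ³)) − δ tends to 0. Mechanism:
Boltzmann–Einstein typicality — static large deviations of coarse-grained (ρ,m,E) profiles under the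
flow-INVARIANT canonical Gibbs measure (rate βE − S_hs), transferred to local-Gibbs data using
dP₀/dλ = exp((N+1)·linear functional of the initial empirical fields) and pathwise energy
conservation (exponent gap = δ). Differs from EntropyBookkeeping.MacroSecondLaw (stmt-4514):
specialised to the flow map, boxed (dilute) instead of density-floored, and benchmarked on the Euler
data (ρ,u,θ)(0) so that no local-Gibbs LLN fact is needed in the assembly; 4514 together with
localGibbs_lln implies it, so either closes X4. [difficulty: L] -/
@[route_item "route-AtomisticToContinuum-GermanoSplitLES", crux]
def EntropyTypicality : Prop :=
  ∃ η₀ : ℝ, 0 < η₀ ∧ ∀ (a₀ θ₀ : Literature.MathematicalPhysics.KineticTheory.T3 → ℝ) (u₀ : Literature.MathematicalPhysics.KineticTheory.T3 → Literature.MathematicalPhysics.KineticTheory.V3), Continuous a₀ → Continuous θ₀ → Continuous u₀ → (∀ x, 0 < a₀ x) → (∀ x, 0 < θ₀ x) → ∃ σ₀ : ℝ, 0 < σ₀ ∧ ∀ σ : ℝ, 0 < σ → σ < σ₀ → ∀ (T : ℝ) (ρ θ : ℝ → Literature.MathematicalPhysics.KineticTheory.T3 → ℝ) (u : ℝ → Literature.MathematicalPhysics.KineticTheory.T3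 → Literature.MathematicalPhysics.KineticTheory.V3), Literature.MathematicalPhysics.KineticTheory.IsHardSphereEulerSolution σ T ρ u θ → (∀ t ∈ Set.Ico 0 T, ∀ x, ρ t x * σ ^ 3 < η₀) → ∀ Φ : (N : ℕ) → Literature.Analysis.FluidPDE.HardSphereFlow (Literature.Analysis.FluidPDE.Torus.geometry (Fin 3)) (Literature.MathematicalPhysics.KineticTheory.hsDiameter σ N) (N + 1), Literature.MathematicalPhysics.KineticTheory.TendstoHydroFieldsAt (fun N => Literature.MathematicalPhysics.KineticTheory.localGibbsLaw σ a₀ u₀ θ₀ N (Φ N)) Φ ρ u θ 0 → ∀ G : Literature.MathematicalPhysics.KineticTheory.T3 → ℝ, Continuous G → (∀ x, 0 ≤ G x) → (∫ x, G x = 1) → ∀ t ∈ Set.Ico 0 T, ∀ (δ c Cρ C : ℝ), 0 < δ → 0 < c → Cρ * σ ^ 3 < η₀ → Filter.Tendsto (fun N : ℕ => Literature.MathematicalPhysics.KineticTheory.localGibbsLaw σ a₀ u₀ θ₀ N (Φ N) {z | let ρG := fun x => Literature.MathematicalPhysics.KineticTheory.empiricalDensityField ((Φ N).flow t z) (fun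 y => G (x - y)); let mG := fun x => Literature.MathematicalPhysics.KineticTheory.empiricalMomentumField ((Φ N).flow t z) (fun y => G (x - y)); let EG := fun x => Literature.MathematicalPhysics.KineticTheory.empiricalEnergyField ((Φ N).flow t z) (fun y => G (x - y)); let θG := fun x => 2 / 3 * (EG x / ρG x - ‖mG x‖ ^ 2 / (2 * ρG x ^ 2)); (∀ x, c ≤ ρG x ∧ ρG x ≤ Cρ ∧ ‖mG x‖ ≤ C ∧ EG x ≤ C ∧ c ≤ θG x) ∧ (∫ x, ρG x * (3 / 2 * Real.log (θG x) - Real.log (ρG x) - Literature.MathematicalPhysics.KineticTheory.hsExcessFreeEnergy (ρG x * σ ^ 3))) < (∫ x, ρ 0 x * (3 / 2 * Real.log (θ 0 x) - Real.log (ρ 0 x) - Literature.MathematicalPhysics.KineticTheory.hsExcessFreeEnergy (ρ 0 x * σ ^ 3))) - δ}) Filter.atTop (nhds 0)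

/-- item stmt-AtomisticToContinuum-9201 · crux · rank 6 · open · by planner
why it might fail: A sup over (s,x) of scale-ℓ_N block fields is a DYNAMIC moderate-deviation bound: block tails exp(−cNℓ_N³) = e^{−o(N)} escape the O(N) relative entropy of local-Gibbs data w.r.t. the invariant measure (static LDP + Liouville don't transfer); a transient ℓ_N-pocket w.p. ↛ 0 before T refutes it.
sources: Spohn1991, OllaVaradhanYau1993, KipnisLandim1999, GarridoGoldsteinLebowitz2004, arXiv:2008.10403, Yau1991
[crux] (card SS4, tails) for every target band η₀ > 0 and profiles ∃ σ₀ ∀ σ < σ₀, for every guarded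
classical solution, admissible kinetic filter and t < T there are 0 < c, C_ρ, C with C_ρσ³ < η₀, the
classical solution strictly inside the box on [0,t], and local-Gibbs probability → 1 that the
mollified empirical fields U_N^{ℓ_N}(s,x) stay in the box {c ≤ ρ ≤ C_ρ, |m| ≤ C, E ≤ C, θ ≥ c} for
ALL s ≤ t and x ∈ 𝕋³ (no mesoscopic vacuum, hot or dense pockets are created by the dynamics before
T). [difficulty: XL] -/
@[route_item "route-AtomisticToContinuum-GermanoSplitLES", crux]
def KineticRangeControl : Prop :=
  ∀ η₀ : ℝ, 0 < η₀ → ∀ (a₀ θ₀ : Literature.MathematicalPhysics.KineticTheory.T3 → ℝ) (u₀ : Literature.MathematicalPhysics.KineticTheory.T3 → Literature.MathematicalPhysics.KineticTheory.V3), Continuous a₀ → Continuous θ₀ → Continuous u₀ → (∀ x, 0 < a₀ x) → (∀ x, 0 < θ₀ x) → ∃ σ₀ : ℝ, 0 < σ₀ ∧ ∀ σ : ℝ, 0 < σ → σ < σ₀ → ∀ (T : ℝ) (ρ θ : ℝ → Literature.MathematicalPhysics.KineticTheory.T3 → ℝ) (u : ℝ → Literature.MathematicalPhysics.KineticTheory.T3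 → Literature.MathematicalPhysics.KineticTheory.V3), Literature.MathematicalPhysics.KineticTheory.IsHardSphereEulerSolution σ T ρ u θ → (∀ t ∈ Set.Ico 0 T, ∀ x, ρ t x * σ ^ 3 < η₀) → ∀ Φ : (N : ℕ) → Literature.Analysis.FluidPDE.HardSphereFlow (Literature.Analysis.FluidPDE.Torus.geometry (Fin 3)) (Literature.MathematicalPhysics.KineticTheory.hsDiameter σ N) (N + 1), Literature.MathematicalPhysics.KineticTheory.TendstoHydroFieldsAt (fun N => Literature.MathematicalPhysics.KineticTheory.localGibbsLaw σ a₀ u₀ θ₀ N (Φ N)) Φ ρ u θ 0 → ∀ (φ : ℕ → Literature.MathematicalPhysics.KineticTheory.T3 → ℝ) (ℓ : ℕ → ℝ), (∀ N, Continuous (φ N)) → (∀ N x, 0 ≤ φ N x) → (∀ N, ∫ x, φ N x = 1) → (∀ N x, ℓ N < Literature.Analysis.FluidPDE.Torus.euclidDist x 0 → φ N x = 0) → (∃ A : ℝ, ∀ N x y, φ N x * ℓ N ^ 3 ≤ A ∧ |φ N x - φ N y| * ℓ N ^ 4 ≤ A * Literature.Analysis.FluidPDE.Torus.euclidDist x y)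 → (∀ N, 0 < ℓ N) → Filter.Tendsto ℓ Filter.atTop (nhds 0) → Filter.Tendsto (fun N : ℕ => ((N : ℝ) + 1) * ℓ N ^ 3 / Real.log ((N : ℝ) + 2)) Filter.atTop Filter.atTop → ∀ t ∈ Set.Ico 0 T, ∃ c Cρ C : ℝ, 0 < c ∧ Cρ * σ ^ 3 < η₀ ∧ (∀ s ∈ Set.Icc 0 t, ∀ x, c < ρ s x ∧ ρ s x < Cρ ∧ ‖ρ s x • u s x‖ < C ∧ Literature.MathematicalPhysics.KineticTheory.totalEnergyDensity (ρ s x) (u s x) (θ s x) < C ∧ c < θ s x) ∧ Filter.Tendsto (fun N : ℕ => Literature.MathematicalPhysics.KineticTheory.localGibbsLaw σ a₀ u₀ θ₀ N (Φ N) {z | let ρℓ := fun s x => Literature.MathematicalPhysics.KineticTheory.empiricalDensityField ((Φ N).flow s z) (fun y => φ N (x - y)); let mℓ := fun s x => Literature.MathematicalPhysics.KineticTheory.empiricalMomentumField ((Φ N).flow s z) (fun y => φ N (x - y)); let Eℓ := fun s x => Literature.MathematicalPhysics.KineticTheory.empiricalEnergyField ((Φ N).flow s z) (fun y => φ N (x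 - y)); let θℓ := fun s x => 2 / 3 * (Eℓ s x / ρℓ s x - ‖mℓ s x‖ ^ 2 / (2 * ρℓ s x ^ 2)); ∃ s ∈ Set.Icc 0 t, ∃ x, ¬ (c ≤ ρℓ s x ∧ ρℓ s x ≤ Cρ ∧ ‖mℓ s x‖ ≤ C ∧ Eℓ s x ≤ C ∧ c ≤ θℓ s x)}) Filter.atTop (nhds 0)

/-- item stmt-AtomisticToContinuum-17775 · crux · rank 7 · open · by planner
why it might fail: ET/KFC are fixed-time and rate-less ⇒ only finitely many N-independent times; FES needs entropy/residual bounds ∀ s ≤ t, so s ↦ V(s) must be equicontinuous N-uniformly w.h.p. — collisional transfer and fast-particle energy have no such bound from conservation + KRC box; ET is at kernel G ≠ φ_N∗G.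
sources: FjordholmEtAl2020, Germano2007, Dafermos1979, ConstantinETiti1994, Spohn1991
[crux] (Germano-split closure = the route's glue in frame form X → Statement, X the thesis
conjunction) KineticFilterConsistency ∧ MesoQuiescence ∧ FilteredEntropyStability ∧
EntropyTypicality ∧ KineticRangeControl → HydrodynamicLimit (the packing-guarded sub-problem
Statement `_root_.HydrodynamicLimit` by name): the probabilistic bookkeeping of the filtered
relative-entropy argument, provable now but long. Proof plan: fix ε; FES gives δ and test functions
Ψ_i = Dη(Ū)-type on KRC's box; choose an even bump G = G_{ℓ₂} with ℓ₂ so small that ‖Ū₀∗G − Ū₀‖ and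
the MesoQuiescence radius are below δ; run FES pathwise on V = U_N^{ℓ_N}∗G on the intersection of
the good events: residuals of V against Ψ_i = residuals of U_N^{ℓ_N} against G∗Ψ_i (Germano
identity, KFC) + Leonard terms ≤ C_K·structure function (Taylor on the box, MQ, Fubini/Markov in
(h,h′)); entropy from ET at kernel φ_{ℓ_N}∗G ≈ G (uniform continuity of G on the box, finite time
net, o(1) collision jumps); box from KRC (the box is convex, averaging preserves it); initial term
from the LLN hypothesis; then ‖V(t) − Ū(t)‖_{L²} ≤ ε w.h.p. and testing against continuous χ
(uniform continuity, mass/energy bounds from conservation + LL -/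
@[route_item "route-AtomisticToContinuum-GermanoSplitLES", crux]
def GermanoSplitClosure : Prop :=
  KineticFilterConsistency ∧ MesoQuiescence ∧ FilteredEntropyStability ∧ EntropyTypicality ∧ KineticRangeControl → _root_.HydrodynamicLimit

/-- item stmt-AtomisticToContinuum-0768 · support · rank 9 · closed · proved by Summit.AtomisticToContinuum.HydrodynamicLimit.Theorems.hsEosLowDensity_proof (prover) · by planner
sources: Ruelle1969, LebowitzPenrose1964
[support] Hard-sphere equation of state at low density: ∃ η₀ > 0 and F real-analytic on (−η₀, η₀)
with hsExcessFreeEnergy = F on [0, η₀), F(0) = 0, F'(0) = 2π/3 (second virial coefficient of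
unit-diameter spheres), and the canonical thermodynamic limit −N⁻¹ log hsFreeVolume η N → F(η)
exists (not just limsup) for η ∈ [0, η₀). Ruelle1969 §3.4 (existence), LebowitzPenrose1964
(convergence of the virial expansion ⇒ analyticity). Makes hsCompressibility/hsPressure smooth and
Z(η) = 1 + (2π/3)η + O(η²); needed by every route (hyperbolicity of the Euler system, virial
theorem). -/
@[route_item "route-AtomisticToContinuum-GermanoSplitLES"]
def HsEosLowDensity : Prop :=
  ∃ η₀ : ℝ, 0 < η₀ ∧ ∃ F : ℝ → ℝ, AnalyticOnNhd ℝ F (Set.Ioo (-η₀) η₀) ∧ Set.EqOn Literature.MathematicalPhysics.KineticTheory.hsExcessFreeEnergy F (Set.Ico 0 η₀) ∧ F 0 = 0 ∧ deriv F 0 = 2 * Real.pi / 3 ∧ ∀ η ∈ Set.Ico 0 η₀, Filter.Tendsto (fun N : ℕ => -(N : ℝ)⁻¹ * Real.log (Literature.MathematicalPhysics.KineticTheory.hsFreeVolume η N)) Filter.atTop (nhds (F η))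

/-- `HsEosLowDensity` holds: proved by `Summit.AtomisticToContinuum.HydrodynamicLimit.Theorems.hsEosLowDensity_proof`. -/
theorem HsEosLowDensity_holds : HsEosLowDensity := _root_.Summit.AtomisticToContinuum.HydrodynamicLimit.Theorems.hsEosLowDensity_proof

-- earlier Assembly (stmt-AtomisticToContinuum-17398, replaced 2026-08-16T23:42:13Z -> stmt-AtomisticToContinuum-17868): retired by None — KineticFilterConsistency → MesoQuiescence → FilteredEntropyStability → EntropyTypicality → KineticRangeControl → _root_.HydrodynamicLimit
-- earlier Assembly (stmt-AtomisticToContinuum-17868, replaced 2026-08-16T23:43:25Z -> stmt-AtomisticToContinuum-17883): retired by None — KineticFilterConsistency → MesoQuiescence → FilteredEntropyStability → EntropyTypicality → KineticRangeControl → GermanoSplitClosure → _root_.HydrodynamicLimit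
-- earlier Assembly (stmt-AtomisticToContinuum-9203, replaced 2026-08-16T23:18:19Z -> stmt-AtomisticToContinuum-17398): retired by None — KineticFilterConsistency → MesoQuiescence → FilteredEntropyStability → EntropyTypicality → KineticRangeControl → DiluteSelfConsistency → _root_.HydrodynamicLimit
/-- item stmt-AtomisticToContinuum-17883 · assembly · rank 1 · open · by planner
sources: Spohn1991, FjordholmEtAl2020, Dafermos1979
[assembly] frame #1 `X → Statement` in curried form: KineticFilterConsistency → MesoQuiescence →
FilteredEntropyStability → EntropyTypicality → KineticRangeControl → HydrodynamicLimit (the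
packing-guarded sub-problem Statement `_root_.HydrodynamicLimit` by name) — the probabilistic
bookkeeping of the filtered relative-entropy argument, provable now but long. Logically equivalent
to the crux GermanoSplitClosure (stmt-AtomisticToContinuum-17775, ∧-form, rank 7), which carries the
staffing, the why-might-fail line, the sources and the proof plan; since the crux-only repair
2026-08-16 this item is NOT a hypothesis of the deciding theorem `closes` (only crux items may be)
and it closes in one line once GermanoSplitClosure is proved (`fun h₁ h₂ h₃ h₄ h₅ => gsc ⟨h₁, h₂,
h₃, h₄, h₅⟩`). The canonical frame `all six cruxes → Statement` (verbatim the type of `closes`) was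
installed at rev 8 (stmt-17868) and is rejected by the ground battery as trivially true
(ground.trivial, blocking READY); an assembly-kind item can be neither re-kinded nor dropped, hence
this content form (the rev 5–7 statement) is restored. [deps: KineticFilterConsistency,
MesoQuiescence, FilteredEntropyStability, EntropyT -/
@[route_item "route-AtomisticToContinuum-GermanoSplitLES"]
def Assembly : Prop :=
  KineticFilterConsistency → MesoQuiescence → FilteredEntropyStability → EntropyTypicality → KineticRangeControl → _root_.HydrodynamicLimit

/-! D-0027 §2.1 — DECIDING THEOREM (planner-authored via `route open/edit --closes-file`; by planner-rbadge-AtomisticToContinuum-GermanoSpl-deb56274-0 2026-08-16T23:35:49Z):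
its hypotheses are this route's items and its conclusion the sub-problem Statement (glue_lint), and it elaborates with this file. -/

@[closes "route-AtomisticToContinuum-GermanoSplitLES"] theorem closes (h₁ : KineticFilterConsistency) (h₂ : MesoQuiescence) (h₃ : FilteredEntropyStability)
    (h₄ : EntropyTypicality) (h₅ : KineticRangeControl) (h₆ : GermanoSplitClosure) : _root_.HydrodynamicLimit :=
  h₆ ⟨h₁, h₂, h₃, h₄, h₅⟩

end Summit.AtomisticToContinuum.HydrodynamicLimit.Theses.GermanoSplitLES
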